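import Summits.Ventures.CertifiedManyBodySolver.Downfold.EmeryBilayerMirror
import Mathlib.Data.Matrix.ColumnRowPartitioned
import Mathlib.LinearAlgebra.Matrix.ToLinearEquiv
import HarnessLib

/-!
# The mirror-symmetric TRILAYER (outer | inner | outer): its odd sheet is EXACTLY the bare outer single layer

Venture CertifiedManyBodySolver, cell `pub/hubbard-downfold` (stage S1 = ROUTER; the trilayer box #35 HgBa₂Ca₂Cu₃O₈ with
per-plane OP / IP objects and three pressure columns), seat hubbard-downfold-mod-4 (technique B); namespace
`Summit.Ventures.CertifiedManyBodySolver.Downfold.Emery`. Sequel of `EmeryBilayerMirror`. Everything here is PROVED.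
WHAT THIS IS NOT: a statement about any material; the mirror symmetry of the two outer planes about the inner
one and the absence of a DIRECT outer–outer interlayer term are hypotheses (ideal P4/mmm Hg-1223; the located
outer–outer one-band Wannier element is small but not zero).

* §1 (any commutative ring; any blocks `H` (outer), `H′` (inner), `T` (adjacent-plane coupling)): the trilayer
  matrix `trilayer H H′ T` on `(OP₁ | IP, OP₂)` = `fromBlocks H [T 0] [T; 0] (fromBlocks H′ T T H)`; the ODD vector
  `oddVec v = (v, 0, −v)` satisfies `trilayer *ᵥ oddVec v = oddVec (H *ᵥ v)` (`trilayer_mulVec_oddVec`) — the inner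
  plane drops out identically; hence over a domain `det (H − ε) = 0 → det (trilayer − ε) = 0`
  (`det_trilayer_sub_eq_zero_of_outer`): EVERY outer single-layer band energy is a trilayer band energy at the same
  `k`, whatever `H′` and `T`.
* §2 Emery specialisation (`trilayerPP`: outer and inner `fourBandPP` with their own parameters, axial interlayer
  term `axialInterlayer t⊥_ss t⊥_sp` between ADJACENT planes only): `det_trilayerPP_eq_zero_of_outer` and, with
  `EmeryAxialFermiSurfaceShape.det_fourBandPP_eq_zero_iff_oneBand`, `trilayerPP_odd_sheet_oneBand`: the odd sheet
  of the trilayer is EXACTLY the outer plane's own `t–t′` contour with the UNSHIFTED axial admixture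
  `a = t_sp²/(ε_s − ε)` — no interlayer co-shift at all (contrast the bilayer, where both sheets are shifted). For
  box #35: the OP one-band / 3BE objects apply VERBATIM to one of the three sheets; the other two live in the even
  `(OP_sym, IP)` sector with `√2`-enhanced coupling (not treated here).

Sources: [AndersenEtAl1995, Eq. (7) (parity sectors of multilayers)]; [PavariniEtAl2001, Eqs. (1)–(3)].
-/

noncomputable section

namespace Summit.Ventures.CertifiedManyBodySolver.Downfold.Emery

open Matrix

/-! ## §1 The odd sector of a mirror-symmetric trilayer -/

section Mirror3

variable {n : Type*} [Fintype n] [DecidableEq n] {R : Type*} [CommRing R]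

/-- **The mirror-symmetric trilayer** on `(OP₁ | IP, OP₂)`: outer blocks `H`, inner block `H′`, adjacent-plane
coupling `T` (OP₁–IP and IP–OP₂), NO direct OP₁–OP₂ term. [cite: AndersenEtAl1995, Eq. (7)] -/
def trilayer (H H' T : Matrix n n R) : Matrix (n ⊕ (n ⊕ n)) (n ⊕ (n ⊕ n)) R :=
  fromBlocks H (fromCols T 0) (fromRows T 0) (fromBlocks H' T T H)

/-- The ODD (outer-antisymmetric) vector `(v, 0, −v)`. [folklore] -/
def oddVec (v : n → R) : n ⊕ (n ⊕ n) → R := Sum.elim v (Sum.elim 0 (-v))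

omit [DecidableEq n] in
/-- **The inner plane drops out of the odd sector identically**: `trilayer H H′ T *ᵥ (v, 0, −v) = (Hv, 0, −Hv)` for
every `H′`, `T`. [cite: AndersenEtAl1995, Eq. (7)] -/
theorem trilayer_mulVec_oddVec (H H' T : Matrix n n R) (v : n → R) :
    trilayer H H' T *ᵥ oddVec v = oddVec (H *ᵥ v) := by
  unfold trilayer oddVec
  rw [fromBlocks_mulVec, Sum.elim_comp_inl, Sum.elim_comp_inr, fromCols_mulVec_sumElim, fromRows_mulVec,
    fromBlocks_mulVec, Sum.elim_comp_inl, Sum.elim_comp_inr]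
  ext i
  rcases i with i | i | i <;> simp [Matrix.mulVec_neg, Matrix.mulVec_zero]

omit [Fintype n] [DecidableEq n] in
/-- `oddVec` is linear in the obvious way: `oddVec (ε • v) = ε • oddVec v`. [folklore] -/
theorem oddVec_smul (ε : R) (v : n → R) : oddVec (ε • v) = ε • oddVec v := by
  ext i
  rcases i with i | i | i <;> simp [oddVec]

omit [Fintype n] [DecidableEq n] in
/-- `oddVec v = 0 ↔ v = 0`. [folklore] -/
theorem oddVec_eq_zero_iff (v : n → R) : oddVec v = 0 ↔ v = 0 := by
  constructor
  · intro h
    funext j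
    have := congrFun h (Sum.inl j)
    simpa [oddVec] using this
  · intro h
    subst h
    ext i
    rcases i with i | i | i <;> simp [oddVec]

omit [DecidableEq n] in
/-- An outer-layer eigenvector gives a trilayer eigenvector with the SAME eigenvalue: `H v = ε v ⇒
trilayer (v, 0, −v) = ε (v, 0, −v)`. [cite: AndersenEtAl1995, Eq. (7)] -/
theorem trilayer_mulVec_oddVec_of_eigen {H : Matrix n n R} (H' T : Matrix n n R) {v : n → R} {ε : R}
    (hv : H *ᵥ v = ε • v) : trilayer H H' T *ᵥ oddVec v = ε • oddVec v := by
  rw [trilayer_mulVec_oddVec, hv, oddVec_smul]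

/-- **EVERY OUTER SINGLE-LAYER BAND ENERGY IS A TRILAYER BAND ENERGY** (over a domain): `det(H − ε) = 0 →
det(trilayer H H′ T − ε) = 0`, for all `H′`, `T`. [cite: AndersenEtAl1995, Eq. (7)] -/
theorem det_trilayer_sub_eq_zero_of_outer [IsDomain R] (H H' T : Matrix n n R) (ε : R)
    (h : (H - ε • (1 : Matrix n n R)).det = 0) :
    (trilayer H H' T - ε • (1 : Matrix (n ⊕ (n ⊕ n)) (n ⊕ (n ⊕ n)) R)).det = 0 := by
  obtain ⟨v, hv0, hv⟩ := Matrix.exists_mulVec_eq_zero_iff.mpr h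
  have hHv : H *ᵥ v = ε • v := by
    rw [Matrix.sub_mulVec, Matrix.smul_mulVec, Matrix.one_mulVec, sub_eq_zero] at hv
    exact hv
  refine Matrix.exists_mulVec_eq_zero_iff.mp ⟨oddVec v, ?_, ?_⟩
  · exact fun h0 => hv0 ((oddVec_eq_zero_iff v).mp h0)
  · rw [Matrix.sub_mulVec, Matrix.smul_mulVec, Matrix.one_mulVec, trilayer_mulVec_oddVec_of_eigen H' T hHv,
      sub_self]

end Mirror3

/-! ## §2 The Hg-1223-type trilayer of the four-orbital model: the odd sheet is the bare outer plane -/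

/-- **The four-orbital trilayer**: outer planes `fourBandPP Δ ε_s …`, inner plane `fourBandPP Δ′ ε_s′ …` (own
parameters), adjacent-plane axial interlayer terms `axialInterlayer t⊥_ss t⊥_sp`, no direct outer–outer term.
[cite: AndersenEtAl1995, Eq. (7)] -/
def trilayerPP (Δ εs tpd tpp c tsp Δ' εs' tpd' tpp' c' tsp' tss tspP sx sy : ℝ) :
    Matrix (Fin 4 ⊕ (Fin 4 ⊕ Fin 4)) (Fin 4 ⊕ (Fin 4 ⊕ Fin 4)) ℝ :=
  trilayer (fourBandPP Δ εs tpd tpp c tsp sx sy) (fourBandPP Δ' εs' tpd' tpp' c' tsp' sx sy)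
    (axialInterlayer tss tspP sx sy)

/-- **Every OUTER-plane single-layer band energy is a trilayer band energy at the same `k`** — for all inner-plane
parameters and all interlayer amplitudes. [cite: AndersenEtAl1995, Eq. (7)] -/
theorem det_trilayerPP_eq_zero_of_outer (Δ εs tpd tpp c tsp Δ' εs' tpd' tpp' c' tsp' tss tspP sx sy ε : ℝ)
    (h : (fourBandPP Δ εs tpd tpp c tsp sx sy - ε • (1 : Matrix (Fin 4) (Fin 4) ℝ)).det = 0) :
    (trilayerPP Δ εs tpd tpp c tsp Δ' εs' tpd' tpp' c' tsp' tss tspP sx sy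
        - ε • (1 : Matrix (Fin 4 ⊕ (Fin 4 ⊕ Fin 4)) (Fin 4 ⊕ (Fin 4 ⊕ Fin 4)) ℝ)).det = 0 :=
  det_trilayer_sub_eq_zero_of_outer _ _ _ ε h

/-- **THE ODD SHEET IS THE OUTER PLANE'S OWN `t–t′` CONTOUR, UNSHIFTED.** For `ε ≠ ε_s`: if `k = (kx, ky)` lies on
the outer plane's single-layer contour at energy `ε` — the pure `t–t′` contour with the UNshifted axial admixture
`a = t_sp²/(ε_s − ε)` of `EmeryAxialFermiSurfaceShape.det_fourBandPP_eq_zero_iff_oneBand` — then `ε` is a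
trilayer band energy at `k`. Contrast `EmeryBilayerMirror.det_bilayerPP_eq_zero_iff_oneBand`: in the bilayer BOTH
sheets are co-shifted (`ε_s ± t⊥_ss`); in the trilayer one sheet is not shifted at all.
[cite: AndersenEtAl1995, Eq. (7)]; [cite: PavariniEtAl2001, Eqs. (1)–(3)] -/
theorem trilayerPP_odd_sheet_oneBand (Δ εs tpd tpp c tsp Δ' εs' tpd' tpp' c' tsp' tss tspP kx ky ε γ : ℝ)
    (hε : ε ≠ εs)
    (hk : oneBand γ (fsT Δ tpd (tpp + tsp ^ 2 / (εs - ε)) (c + tsp ^ 2 / (εs - ε)) ε)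
        (fsTp tpd (tpp + tsp ^ 2 / (εs - ε)) (c + tsp ^ 2 / (εs - ε)) ε) 0 kx ky
      = γ - 4 * fsT Δ tpd (tpp + tsp ^ 2 / (εs - ε)) (c + tsp ^ 2 / (εs - ε)) ε
          - 4 * fsTp tpd (tpp + tsp ^ 2 / (εs - ε)) (c + tsp ^ 2 / (εs - ε)) ε + cA Δ ε) :
    (trilayerPP Δ εs tpd tpp c tsp Δ' εs' tpd' tpp' c' tsp' tss tspP (Real.sin (kx / 2)) (Real.sin (ky / 2))
        - ε • (1 : Matrix (Fin 4 ⊕ (Fin 4 ⊕ Fin 4)) (Fin 4 ⊕ (Fin 4 ⊕ Fin 4)) ℝ)).det = 0 :=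
  det_trilayerPP_eq_zero_of_outer _ _ _ _ _ _ _ _ _ _ _ _ _ _ _ _ ε
    ((det_fourBandPP_eq_zero_iff_oneBand Δ εs tpd tpp c tsp kx ky ε γ hε).mpr hk)

/-- On the zone diagonal the odd sheet inherits the single layer's d-sector energies (`dQuad = 0`), like both
bilayer sheets (`EmeryBilayerMirror.det_bilayerPP_diag_of_dQuad`). [folklore] -/
theorem det_trilayerPP_diag_of_dQuad (Δ εs tpd tpp c tsp Δ' εs' tpd' tpp' c' tsp' tss tspP s ε : ℝ)
    (h : dQuad Δ tpd tpp c (s ^ 2) ε = 0) :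
    (trilayerPP Δ εs tpd tpp c tsp Δ' εs' tpd' tpp' c' tsp' tss tspP s s
        - ε • (1 : Matrix (Fin 4 ⊕ (Fin 4 ⊕ Fin 4)) (Fin 4 ⊕ (Fin 4 ⊕ Fin 4)) ℝ)).det = 0 := by
  apply det_trilayerPP_eq_zero_of_outer
  rw [det_fourBandPP_sub_diag, h]
  simp

/-! ## §3 The full factorisation: odd sheet × even `(IP, OP_sym)` sector (appended 2026-08-27) -/

section Mirror3Det

variable {n : Type*} [Fintype n] [DecidableEq n] {R : Type*} [CommRing R]

/-- **TRILAYER FACTORISATION** (any commutative ring): `det (trilayer H H′ T) = det H · det (fromBlocks H′ (T + T) T H)`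
— the odd outer sector `H` times the EVEN sector on `(IP, OP₁ + OP₂)` (coupling doubled on one side; over a field
with `√2` it is the symmetric `[[H′, √2T],[√2T, H]]`), by the block operations `row(OP₁) −= row(OP₂)`,
`col(OP₂) += col(OP₁)`. [cite: AndersenEtAl1995, Eq. (7)] -/
theorem det_trilayer (H H' T : Matrix n n R) :
    (trilayer H H' T).det = H.det * (fromBlocks H' (T + T) T H).det := by
  -- elementary block matrices (det 1)
  set E1 : Matrix (n ⊕ (n ⊕ n)) (n ⊕ (n ⊕ n)) R :=
    fromBlocks (1 : Matrix n n R) (fromCols (0 : Matrix n n R) (-1 : Matrix n n R))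
      (0 : Matrix (n ⊕ n) n R) (1 : Matrix (n ⊕ n) (n ⊕ n) R) with hE1
  set E2 : Matrix (n ⊕ (n ⊕ n)) (n ⊕ (n ⊕ n)) R :=
    fromBlocks (1 : Matrix n n R) (fromCols (0 : Matrix n n R) (1 : Matrix n n R))
      (0 : Matrix (n ⊕ n) n R) (1 : Matrix (n ⊕ n) (n ⊕ n) R) with hE2
  have hd1 : E1.det = 1 := by rw [hE1, det_fromBlocks_zero₂₁, det_one, det_one, mul_one]
  have hd2 : E2.det = 1 := by rw [hE2, det_fromBlocks_zero₂₁, det_one, det_one, mul_one]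
  have h1 : E1 * trilayer H H' T = fromBlocks H (fromCols 0 (-H)) (fromRows T 0) (fromBlocks H' T T H) := by
    rw [hE1, trilayer, fromBlocks_multiply, fromCols_mul_fromRows, fromCols_mul_fromBlocks]
    simp only [Matrix.one_mul, Matrix.zero_mul, Matrix.neg_mul, zero_add, add_zero, neg_zero]
    congr 1
    ext i j
    rcases j with j | j <;> simp [fromCols]
  have h2 : fromBlocks H (fromCols 0 (-H)) (fromRows T 0) (fromBlocks H' T T H) * E2 =
      fromBlocks H 0 (fromRows T 0) (fromBlocks H' (T + T) T H) := by
    rw [hE2, fromBlocks_multiply, mul_fromCols, fromRows_mul_fromCols]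
    simp only [Matrix.mul_one, Matrix.mul_zero, add_zero]
    congr 1
    · ext i j
      rcases j with j | j <;> simp [fromCols]
    · rw [fromBlocks_add]
      simp
  have key := congrArg Matrix.det h2
  rw [← h1, det_mul, det_mul, hd1, hd2, one_mul, mul_one, det_fromBlocks_zero₁₂] at key
  exact key

omit [Fintype n] in
/-- `trilayer H H′ T − ε·1 = trilayer (H − ε·1) (H′ − ε·1) T`. [folklore] -/
theorem trilayer_sub_smul_one (H H' T : Matrix n n R) (ε : R) :
    trilayer H H' T - ε • (1 : Matrix (n ⊕ (n ⊕ n)) (n ⊕ (n ⊕ n)) R) =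
      trilayer (H - ε • (1 : Matrix n n R)) (H' - ε • (1 : Matrix n n R)) T := by
  ext i j
  rcases i with i | i | i <;> rcases j with j | j | j <;>
    simp [trilayer, fromBlocks, fromCols, fromRows, Matrix.one_apply, Matrix.sub_apply, Matrix.smul_apply]

/-- **The trilayer secular determinant factorises** into the ODD outer single layer and the EVEN sector:
`det(trilayer − ε) = det(H − ε) · det(fromBlocks (H′ − ε) (2T) T (H − ε))` — the three sheets are the outer
plane's own bands plus the two bands of the even `(IP, OP_sym)` pair. [cite: AndersenEtAl1995, Eq. (7)] -/
theorem det_trilayer_sub (H H' T : Matrix n n R) (ε : R) :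
    (trilayer H H' T - ε • (1 : Matrix (n ⊕ (n ⊕ n)) (n ⊕ (n ⊕ n)) R)).det =
      (H - ε • (1 : Matrix n n R)).det *
        (fromBlocks (H' - ε • (1 : Matrix n n R)) (T + T) T (H - ε • (1 : Matrix n n R))).det := by
  rw [trilayer_sub_smul_one, det_trilayer]

end Mirror3Det

/-- **Hg-1223-type trilayer: the three sheets.** `det(trilayerPP − ε) = det(OP single layer − ε) · det(even sector
− ε)`, the even sector coupling the INNER plane to the symmetric outer combination through the doubled axial
term `axialInterlayer + axialInterlayer`. [cite: AndersenEtAl1995, Eq. (7)] -/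
theorem det_trilayerPP_sub (Δ εs tpd tpp c tsp Δ' εs' tpd' tpp' c' tsp' tss tspP sx sy ε : ℝ) :
    (trilayerPP Δ εs tpd tpp c tsp Δ' εs' tpd' tpp' c' tsp' tss tspP sx sy
        - ε • (1 : Matrix (Fin 4 ⊕ (Fin 4 ⊕ Fin 4)) (Fin 4 ⊕ (Fin 4 ⊕ Fin 4)) ℝ)).det =
      (fourBandPP Δ εs tpd tpp c tsp sx sy - ε • (1 : Matrix (Fin 4) (Fin 4) ℝ)).det *
        (fromBlocks (fourBandPP Δ' εs' tpd' tpp' c' tsp' sx sy - ε • (1 : Matrix (Fin 4) (Fin 4) ℝ))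
            (axialInterlayer tss tspP sx sy + axialInterlayer tss tspP sx sy) (axialInterlayer tss tspP sx sy)
            (fourBandPP Δ εs tpd tpp c tsp sx sy - ε • (1 : Matrix (Fin 4) (Fin 4) ℝ))).det := by
  unfold trilayerPP
  rw [det_trilayer_sub]

end Summit.Ventures.CertifiedManyBodySolver.Downfold.Emery

end
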